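import Summits.ResolutionOfSingularities.ResolutionOfSingularities.Theorems.PurelyInseparableDim4ResConeThreeWeightsRecurrence
import HarnessLib
import HarnessLib.Audit.Tags

/-!
# Purely inseparable four-folds — the B∞ ASSEMBLY at `(p,d) = (5,3)` IN ABSTRACT POTENTIAL FORM: a frame-carried potential that
# drops strictly at P-states and weakly at Q-states kills the B∞ branch; hence TAIL-B ⟸ (light-branch kill) + (three frame laws)
# (cell `res-dim4-pi`, K2(p) lane, slice C; holder brick A = memo §17 (R4) made kernel modulo NAMED stubs)

[OURS · counted 0 · cell `res-dim4-pi` · K2(p) lane holder res-dim4-p-12 g4.]  Nothing here proves K2(5) (`RidgeBudget.NoAboveFloorTrap 5 5`),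
`NoIsolatedTrap 5 5` or resolution of singularities in dimension ≥ 4 / characteristic `p` — NOT proved; the three frame laws are
HYPOTHESES here (the Φ-line's stubs E/K/L of the holder's HOME skeleton `BInf-ASSEMBLY-SKELETON.lean` b10e0a76a4b9b1eb, owners
res-dim4-p-9 g4 / res-dim4-p-7 g4 / res-dim4-p-2 g5 over res-dim4-p-11 g4's (K-Φ2) IX/X/XIII).  AI kernel work, weaker than expert review.

The assembly of memo §17 (R4) never looks inside the carried label: it only uses that (E) an ENTRY datum exists at every Q-state,
(L) a Q-step turns an entry datum into a RUN datum of the child with potential NOT larger, (K) a P-step turns a run datum into a run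
datum of the child with potential STRICTLY smaller, and (RE) run data are entry data.  So this file proves, for an ARBITRARY datum type
`Fr`, predicates `E R : ℕ → Fr → Prop` and potential `Φ : ℕ → Fr → ℕ` along a witnessed isolated above-floor `Step0 5` chain of
constant shade `3` with `x^{r₀} ∣ F₀`:
* **`no_bInf_tail_of_potential`** — (E)+(L)+(K)+(RE) on the heavy branch (one weight-`2` letter from `k₁`) ⇒ `False`: a Q-state `kₑ ≥ k₁`
  exists (`exists_degree_four`, W′ p701342), the data propagate with `#P-states so far + Φ ≤ Φ₀`, and a bounded number of P-states
  contradicts W's dock `no_three_tail_of_degree_three_budget` (p700619);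
* **`tailB_of_light_of_potential`** — TAIL-B's `d = 3` block of the socket (`…SliceCSocket` p700823) for the chain, GIVEN a kill of the
  LIGHT branch `(1,1,1)` and the four hypotheses (by W's `three_weights_dichotomy`).
INSTANTIATION (to come, one file when the stubs land): `Fr := Fin 4 × (Fin (2+2) → Fin 4 → K) × (Fin 4 → Fin (2+2) → K)` (critical letter
+ linear frame + inverse), `E/R :=` the skeleton's `EntryInv/RunInv` (frame, `u₁ = e_h`, y-rows annihilating `resVertex`, `r h = 2`, polygon
`pts ≠ ∅`, `3! < δs`, `αs < 3!` [+ `0 < αs`]), `Φ := betaS` of the frame — then (E) = `stub_entryFrame`, (L) = `stub_lose`, (K) = `stub_keep`.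

[cite: CossartJannsenSaito2020, Thm. 3.14, Lemma 13.4, Thm. 13.7] [cite: HauserPerlega2019PRIMS, §2 (transform D′ of D)]
bears_on: LADDER-RESOLUTION:D157-DOOR2 (res-dim4-pi · K2(p) · slice C `(5,3)` B∞ assembly, abstract).  Supports
stmt-ResolutionOfSingularities-16155 (helper).
-/

set_option linter.dupNamespace false -- mandated namespace of this single-conjunct summit

noncomputable section

namespace Summit.ResolutionOfSingularities.ResolutionOfSingularities.Theorems.PIDim4

namespace ResCone

open MvPolynomial Finset
open Literature.AlgebraicGeometry.Resolution
open Literature.AlgebraicGeometry.Resolution.CentreBlowup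
open Literature.AlgebraicGeometry.Resolution.Hauser2010
open Literature.AlgebraicGeometry.Resolution.HauserPerlega2019

variable {K : Type} [Field K] [CharP K 5] [DecidableEq K]

/-- **THE B∞ ASSEMBLY IN POTENTIAL FORM.**  Along a witnessed isolated above-floor `Step0 5` chain with `x^{r₀} ∣ F₀` and constant shade
`3` from `k₀`, suppose every state from `k₁ ≥ k₀` carries a weight-`2` letter (the B∞ branch of `three_weights_dichotomy`), and suppose a
datum type `Fr` with ENTRY/RUN predicates `E R` and a potential `Φ` satisfies: (E) at every Q-state (`|r_k| = 4`) an entry datum exists;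
(L) at every Q-state an entry datum yields a run datum of the child with `Φ` not larger; (K) at every P-state (`|r_k| = 3`) a run datum
yields a run datum of the child with `Φ` strictly smaller; (RE) run data are entry data.  Then `False`. [OURS]
[cite: CossartJannsenSaito2020, Thm. 3.14, Thm. 13.7] -/
theorem no_bInf_tail_of_potential {c : ℕ → State K} {j : ℕ → Fin 4} {b : ℕ → Fin 4 → K}
    (hc : ∀ k, IsIsolated 5 (c k).F ∧ Step0 5 (c k) (c (k + 1))) (hw : FreeTail.IsWitnessedChain 5 c j b)
    (hr0 : ∀ e ∈ (c 0).F.support, (c 0).r ≤ e) (hfloor : ∀ k, ordZero (c k).F ≠ 5) {k₀ : ℕ}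
    (hshade : ∀ k, k₀ ≤ k → (c k).shade = ((3 : ℕ) : ℕ∞)) {k₁ : ℕ} (hk₁ : k₀ ≤ k₁)
    (hheavy : ∀ k, k₁ ≤ k → ∃ W, (c k).r W = 2)
    {Fr : Type} (E R : ℕ → Fr → Prop) (Φ : ℕ → Fr → ℕ)
    (hE : ∀ k, k₁ ≤ k → (c k).r.degree = 4 → ∃ f, E k f)
    (hL : ∀ k, k₁ ≤ k → (c k).r.degree = 4 → ∀ f, E k f → ∃ f', R (k + 1) f' ∧ Φ (k + 1) f' ≤ Φ k f)
    (hK : ∀ k, k₁ ≤ k → (c k).r.degree = 3 → ∀ f, R k f → ∃ f', R (k + 1) f' ∧ Φ (k + 1) f' < Φ k f)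
    (hRE : ∀ k f, R k f → E k f) : False := by
  haveI : Fact (Nat.Prime 5) := ⟨by norm_num⟩
  classical
  obtain ⟨-, hlaw, hbj, hfl, hpair⟩ := three_weights_laws hc hw hr0 hfloor hshade
  -- an entry Q-state `kₑ ≥ k₁`
  obtain ⟨kₑ, hkₑ, h4⟩ := exists_degree_four hc hw hr0 hfloor hshade hk₁ hheavy k₁ le_rfl
  obtain ⟨fₑ, hfₑ⟩ := hE kₑ hkₑ h4
  obtain ⟨f₀, hR₀, -⟩ := hL kₑ hkₑ h4 fₑ hfₑ
  -- propagate: at time `kₑ + 1 + n` a run datum with `#P-states so far + Φ ≤ Φ₀`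
  have hprop : ∀ n, ∃ f, R (kₑ + 1 + n) f ∧
      ((Finset.range n).filter (fun i => (c (kₑ + 1 + i)).r.degree = 3)).card + Φ (kₑ + 1 + n) f ≤ Φ (kₑ + 1) f₀ := by
    intro n
    induction n with
    | zero => exact ⟨f₀, by simpa using hR₀, by simp⟩
    | succ n ih =>
      obtain ⟨f, hRf, hbound⟩ := ih
      have hk : k₁ ≤ kₑ + 1 + n := by omega
      have hcard : ((Finset.range (n + 1)).filter (fun i => (c (kₑ + 1 + i)).r.degree = 3)).card =
          ((Finset.range n).filter (fun i => (c (kₑ + 1 + i)).r.degree = 3)).card +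
            (if (c (kₑ + 1 + n)).r.degree = 3 then 1 else 0) := by
        rw [Finset.range_add_one, Finset.filter_insert]
        split_ifs with h3
        · rw [Finset.card_insert_of_notMem (by simp)]
        · rfl
      have heq : kₑ + 1 + (n + 1) = kₑ + 1 + n + 1 := by ring
      have hle4 := degree_le_four hlaw hbj hfl hpair (k := kₑ + 1 + n) (by omega)
      have hge3 := hfl (kₑ + 1 + n) (by omega)
      by_cases h3 : (c (kₑ + 1 + n)).r.degree = 3
      · obtain ⟨f', hR', hlt⟩ := hK _ hk h3 f hRf
        refine ⟨f', by rw [heq]; exact hR', ?_⟩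
        rw [hcard, if_pos h3, heq]
        omega
      · have h4' : (c (kₑ + 1 + n)).r.degree = 4 := by omega
        obtain ⟨f', hR', hle⟩ := hL _ hk h4' f (hRE _ _ hRf)
        refine ⟨f', by rw [heq]; exact hR', ?_⟩
        rw [hcard, if_neg h3, heq]
        omega
  -- the P-visit budget, then W's dock
  refine no_three_tail_of_degree_three_budget hc hw hr0 hfloor hshade (k₁ := kₑ + 1) (by omega)
    (B := Φ (kₑ + 1) f₀) fun n => ?_
  obtain ⟨f, -, hbound⟩ := hprop n
  omega

/-- **TAIL-B FROM A LIGHT-BRANCH KILL AND THE THREE FRAME LAWS (potential form).**  Along a witnessed isolated above-floor `Step0 5`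
chain with `x^{r₀} ∣ F₀`, constant shade `3` and `e_G ≡ 2` from `k₀`: if the LIGHT branch (`|r_k| = 3`, all weights `≤ 1` for every
`k ≥ k₀`) is contradictory, and for every `k₁ ≥ k₀` with the B∞ branch from `k₁` some datum type carries (E)/(L)/(K)/(RE) as in
`no_bInf_tail_of_potential`, then `False` — i.e. the chain satisfies the socket's TAIL-B. [OURS]
[cite: CossartJannsenSaito2020, Thm. 3.14, Thm. 13.7] -/
theorem tailB_of_light_of_potential {c : ℕ → State K} {j : ℕ → Fin 4} {b : ℕ → Fin 4 → K}
    (hc : ∀ k, IsIsolated 5 (c k).F ∧ Step0 5 (c k) (c (k + 1))) (hw : FreeTail.IsWitnessedChain 5 c j b)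
    (hr0 : ∀ e ∈ (c 0).F.support, (c 0).r ≤ e) (hfloor : ∀ k, ordZero (c k).F ≠ 5) {k₀ : ℕ}
    (hshade : ∀ k, k₀ ≤ k → (c k).shade = ((3 : ℕ) : ℕ∞))
    (hlight : (∀ k, k₀ ≤ k → (∀ i, (c k).r i ≤ 1) ∧ (c k).r.degree = 3) → False)
    (hframes : ∀ k₁, k₀ ≤ k₁ → (∀ k, k₁ ≤ k → ∃ W, (c k).r W = 2) →
      ∃ (Fr : Type) (E R : ℕ → Fr → Prop) (Φ : ℕ → Fr → ℕ),
        (∀ k, k₁ ≤ k → (c k).r.degree = 4 → ∃ f, E k f) ∧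
        (∀ k, k₁ ≤ k → (c k).r.degree = 4 → ∀ f, E k f → ∃ f', R (k + 1) f' ∧ Φ (k + 1) f' ≤ Φ k f) ∧
        (∀ k, k₁ ≤ k → (c k).r.degree = 3 → ∀ f, R k f → ∃ f', R (k + 1) f' ∧ Φ (k + 1) f' < Φ k f) ∧
        (∀ k f, R k f → E k f)) : False := by
  rcases three_weights_dichotomy hc hw hr0 hfloor hshade with hL | ⟨k₁, hk₁, hB⟩
  · exact hlight hL
  · have hheavy : ∀ k, k₁ ≤ k → ∃ W, (c k).r W = 2 := fun k hk => by
      obtain ⟨⟨W, hW, -⟩, -⟩ := hB k hk; exact ⟨W, hW⟩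
    obtain ⟨Fr, E, R, Φ, hE, hL', hK, hRE⟩ := hframes k₁ hk₁ hheavy
    exact no_bInf_tail_of_potential hc hw hr0 hfloor hshade hk₁ hheavy E R Φ hE hL' hK hRE

end ResCone

end Summit.ResolutionOfSingularities.ResolutionOfSingularities.Theorems.PIDim4

end
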